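import Summits.ResolutionOfSingularities.ResolutionOfSingularities.Theorems.DeltaCutMirror1
import HarnessLib

/-!
# DeltaCutMirror2 — tree file 2/3 of the decomp-res lens-6 g29 node «MirrorCut» (HOME `decomp-res-lens-6/g29/MirrorCut.lean`)

§B `MCertificatesB` (`p = 3`): `Dm_pderiv_u`, `Dm_top`, `Dm_planes`, `Dm_diff`, `Dm_wild_L`, `Dm_near`,
`Dm_closure_not_prime`, `Dm_crossing_line`, `noTop_one_add_u_mul`, `Dm_lineChart_z_noTop`, bundles
`Dm_gFrozen_certificate` / `Dm_selfReproduction_certificate`.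
The module docstring of `DeltaCutMirror1` (file 1/3) carries the node's summary, the dictionary sentences certified,
the honest ceiling and the
sources; `NODE-g29.md` (HOME) is the record.  Same namespace `…Theorems.DeltaCutClasses`, `variable {K : Type*}
[Field K]`, declarations verbatim
from the lens file. [new; elementary] [folklore]
-/


noncomputable section

open CategoryTheory CategoryTheory.Limits AlgebraicGeometry TopologicalSpace IsLocalRing
open Literature.AlgebraicGeometry.Resolution

universe u

open Summit.ResolutionOfSingularities.ResolutionOfSingularities.Theorems.Rescue.BedZpeBinom4Centre (mul_mem_pow_add)

namespace Summit.ResolutionOfSingularities.ResolutionOfSingularities.Theorems.DeltaCutClasses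

open Summit.ResolutionOfSingularities.ResolutionOfSingularities.Theorems.TwistCutClasses
open Summit.ResolutionOfSingularities.ResolutionOfSingularities.Theorems.LightCutClasses

section MCertificatesB

open MvPolynomial
variable {K : Type*} [Field K]

/-! #### §B — `D′ = z³ + u·t³·w³` (`p = 3`): the F-surf-sing certificate of CROSSING type -/

/-- `∂_u` of the mirror datum: `∂_u D′ = t³·w³` (characteristic-free). [elementary] [folklore] -/
theorem Dm_pderiv_u : pderiv 2 (X 0 ^ 3 + X 2 * X 1 ^ 3 * X 3 ^ 3 : MvPolynomial (Fin 4) K) = X 1 ^ 3 * X 3 ^ 3 := by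
  have e20 := f_ne K (i := 2) (j := 0) (by decide)
  have e21 := f_ne K (i := 2) (j := 1) (by decide)
  have e23 := f_ne K (i := 2) (j := 3) (by decide)
  have e22 := f_self K 2
  simp only [map_add, Derivation.leibniz, Derivation.leibniz_pow, smul_eq_mul, nsmul_eq_mul, e20, e21, e22, e23]
  push_cast; ring

/-- **D′ — (T) THE TOP LOCUS lies in `P_t ∪ P_w = V(z, t·w)`**: a prime `𝔮` with `ord_𝔮(D′) ≥ 3` contains `z` and (`t` or
`w`) (`∂_u D′ = t³w³` forces `t³w³ ∈ 𝔮`, then `z³ = D′ − u·t³w³ ∈ 𝔮`).  Characteristic-free. [new; elementary] [folklore] -/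
theorem Dm_top (𝔮 : Ideal (MvPolynomial (Fin 4) K)) [𝔮.IsPrime] {s : MvPolynomial (Fin 4) K} (hs : s ∉ 𝔮)
    (h : s * (X 0 ^ 3 + X 2 * X 1 ^ 3 * X 3 ^ 3 : MvPolynomial (Fin 4) K) ∈ 𝔮 ^ 3) :
    (X 0 : MvPolynomial (Fin 4) K) ∈ 𝔮 ∧ ((X 1 : MvPolynomial (Fin 4) K) ∈ 𝔮 ∨ (X 3 : MvPolynomial (Fin 4) K) ∈ 𝔮) := by
  have hP := ‹𝔮.IsPrime›
  have hs2 : s ^ 2 ∉ 𝔮 := pow_not_mem 𝔮 hs 2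
  have h1 := sq_mul_deriv_mem_pow 𝔮 h (pderiv 2)
  rw [Dm_pderiv_u] at h1
  have hm : (X 1 ^ 3 * X 3 ^ 3 : MvPolynomial (Fin 4) K) ∈ 𝔮 :=
    (hP.mem_or_mem (Ideal.pow_le_self two_ne_zero h1)).resolve_left hs2
  have hf : (X 0 ^ 3 + X 2 * X 1 ^ 3 * X 3 ^ 3 : MvPolynomial (Fin 4) K) ∈ 𝔮 := mem_of_sMul_mem_cube 𝔮 hs h
  have h0 : (X 0 ^ 3 : MvPolynomial (Fin 4) K) ∈ 𝔮 := by
    have := Ideal.sub_mem _ hf (Ideal.mul_mem_left _ (X 2) hm)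
    rwa [show (X 0 ^ 3 + X 2 * X 1 ^ 3 * X 3 ^ 3 - X 2 * (X 1 ^ 3 * X 3 ^ 3) : MvPolynomial (Fin 4) K) = X 0 ^ 3 by ring]
      at this
  refine ⟨hP.mem_of_pow_mem 3 h0, ?_⟩
  rcases hP.mem_or_mem hm with h | h
  · exact Or.inl (hP.mem_of_pow_mem 3 h)
  · exact Or.inr (hP.mem_of_pow_mem 3 h)

/-- **D′ — (W) BOTH PLANES LIE IN THE TOP LOCUS and are planes**: `D′ ∈ (z,t)³`, `D′ ∈ (z,w)³`; `u, w ∉ (z,t)`, `t, u ∉ (z,w)`.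
With (T): top(D′) `= P_t ∪ P_w` exactly. [new; elementary] [folklore] -/
theorem Dm_planes :
    (X 0 ^ 3 + X 2 * X 1 ^ 3 * X 3 ^ 3 : MvPolynomial (Fin 4) K) ∈ (Ideal.span {(X 0 : MvPolynomial (Fin 4) K), X 1}) ^ 3 ∧
      (X 0 ^ 3 + X 2 * X 1 ^ 3 * X 3 ^ 3 : MvPolynomial (Fin 4) K) ∈ (Ideal.span {(X 0 : MvPolynomial (Fin 4) K), X 3}) ^ 3 ∧
      ((X 2 : MvPolynomial (Fin 4) K) ∉ Ideal.span {(X 0 : MvPolynomial (Fin 4) K), X 1} ∧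
        (X 3 : MvPolynomial (Fin 4) K) ∉ Ideal.span {(X 0 : MvPolynomial (Fin 4) K), X 1}) ∧
      ((X 1 : MvPolynomial (Fin 4) K) ∉ Ideal.span {(X 0 : MvPolynomial (Fin 4) K), X 3} ∧
        (X 2 : MvPolynomial (Fin 4) K) ∉ Ideal.span {(X 0 : MvPolynomial (Fin 4) K), X 3}) := by
  have hp := mirrorF_mem_pow (K := K) 3
  simp only [mirrorF] at hp
  refine ⟨hp.1, hp.2, ⟨?_, ?_⟩, ?_, ?_⟩
  · refine not_mem_span_of_eval _ (fun i => if i = 2 then 1 else 0) ?_ (by simp)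
    intro g hg
    simp only [Set.mem_insert_iff, Set.mem_singleton_iff] at hg
    rcases hg with rfl | rfl <;> simp
  · refine not_mem_span_of_eval _ (fun i => if i = 3 then 1 else 0) ?_ (by simp)
    intro g hg
    simp only [Set.mem_insert_iff, Set.mem_singleton_iff] at hg
    rcases hg with rfl | rfl <;> simp
  · refine not_mem_span_of_eval _ (fun i => if i = 1 then 1 else 0) ?_ (by simp)
    intro g hg
    simp only [Set.mem_insert_iff, Set.mem_singleton_iff] at hg
    rcases hg with rfl | rfl <;> simp
  · refine not_mem_span_of_eval _ (fun i => if i = 2 then 1 else 0) ?_ (by simp)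
    intro g hg
    simp only [Set.mem_insert_iff, Set.mem_singleton_iff] at hg
    rcases hg with rfl | rfl <;> simp

/-- **D′ — (B″) THE DIFFERENTIAL CLOSURE OF ORDER `≤ 2` IS `(D′, t³w³)`** (characteristic `3`): `∂_z D′ = ∂_t D′ = ∂_w D′ =
0`, `∂_u D′ = t³w³`, and `t³w³` is a `3`-constant (`∂ᵢ(t³w³) = 0` for every `i`).  With (W): `Diff^{≤2}(D′) = (D′, t³w³) ⊆
(z,t)³ ∩ (z,w)³` — at EVERY point of `P_t ∪ P_w` (closed or not) the order-`≤ 2` absolute differential closure lies in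
`𝔪³`: NO absolute stalk contact anywhere on the top locus (every top point is BAD in the contact sense). [new; elementary]
[folklore] -/
theorem Dm_diff [CharP K 3] :
    (pderiv 0 (X 0 ^ 3 + X 2 * X 1 ^ 3 * X 3 ^ 3 : MvPolynomial (Fin 4) K) = 0 ∧
      pderiv 1 (X 0 ^ 3 + X 2 * X 1 ^ 3 * X 3 ^ 3 : MvPolynomial (Fin 4) K) = 0 ∧
      pderiv 3 (X 0 ^ 3 + X 2 * X 1 ^ 3 * X 3 ^ 3 : MvPolynomial (Fin 4) K) = 0 ∧
      pderiv 2 (X 0 ^ 3 + X 2 * X 1 ^ 3 * X 3 ^ 3 : MvPolynomial (Fin 4) K) = X 1 ^ 3 * X 3 ^ 3) ∧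
    (∀ i : Fin 4, pderiv i (X 1 ^ 3 * X 3 ^ 3 : MvPolynomial (Fin 4) K) = 0) ∧
    Ideal.span {(X 0 ^ 3 + X 2 * X 1 ^ 3 * X 3 ^ 3 : MvPolynomial (Fin 4) K), X 1 ^ 3 * X 3 ^ 3} ≤
      (Ideal.span {(X 0 : MvPolynomial (Fin 4) K), X 1}) ^ 3 ⊓ (Ideal.span {(X 0 : MvPolynomial (Fin 4) K), X 3}) ^ 3 := by
  have h3 := three_eq_zero_mvPolynomial (K := K)
  have e00 := f_self K 0
  have e01 := f_ne K (i := 0) (j := 1) (by decide)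
  have e02 := f_ne K (i := 0) (j := 2) (by decide)
  have e03 := f_ne K (i := 0) (j := 3) (by decide)
  have e10 := f_ne K (i := 1) (j := 0) (by decide)
  have e11 := f_self K 1
  have e12 := f_ne K (i := 1) (j := 2) (by decide)
  have e13 := f_ne K (i := 1) (j := 3) (by decide)
  have e30 := f_ne K (i := 3) (j := 0) (by decide)
  have e31 := f_ne K (i := 3) (j := 1) (by decide)
  have e32 := f_ne K (i := 3) (j := 2) (by decide)
  have e33 := f_self K 3
  have e20 := f_ne K (i := 2) (j := 0) (by decide)
  have e21 := f_ne K (i := 2) (j := 1) (by decide)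
  have e23 := f_ne K (i := 2) (j := 3) (by decide)
  have e22 := f_self K 2
  have d0 : pderiv 0 (X 0 ^ 3 + X 2 * X 1 ^ 3 * X 3 ^ 3 : MvPolynomial (Fin 4) K) = 0 := by
    simp only [map_add, Derivation.leibniz, Derivation.leibniz_pow, smul_eq_mul, nsmul_eq_mul, e00, e01, e02, e03]
    push_cast
    linear_combination (X 0 ^ 2 : MvPolynomial (Fin 4) K) * h3
  have d1 : pderiv 1 (X 0 ^ 3 + X 2 * X 1 ^ 3 * X 3 ^ 3 : MvPolynomial (Fin 4) K) = 0 := by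
    simp only [map_add, Derivation.leibniz, Derivation.leibniz_pow, smul_eq_mul, nsmul_eq_mul, e10, e11, e12, e13]
    push_cast
    linear_combination (X 2 * X 1 ^ 2 * X 3 ^ 3 : MvPolynomial (Fin 4) K) * h3
  have d3 : pderiv 3 (X 0 ^ 3 + X 2 * X 1 ^ 3 * X 3 ^ 3 : MvPolynomial (Fin 4) K) = 0 := by
    simp only [map_add, Derivation.leibniz, Derivation.leibniz_pow, smul_eq_mul, nsmul_eq_mul, e30, e31, e32, e33]
    push_cast
    linear_combination (X 2 * X 1 ^ 3 * X 3 ^ 2 : MvPolynomial (Fin 4) K) * h3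
  have c0 : pderiv 0 (X 1 ^ 3 * X 3 ^ 3 : MvPolynomial (Fin 4) K) = 0 := by
    simp only [Derivation.leibniz, Derivation.leibniz_pow, smul_eq_mul, nsmul_eq_mul, e01, e03]
    push_cast; ring
  have c1 : pderiv 1 (X 1 ^ 3 * X 3 ^ 3 : MvPolynomial (Fin 4) K) = 0 := by
    simp only [Derivation.leibniz, Derivation.leibniz_pow, smul_eq_mul, nsmul_eq_mul, e11, e13]
    push_cast
    linear_combination (X 1 ^ 2 * X 3 ^ 3 : MvPolynomial (Fin 4) K) * h3
  have c2 : pderiv 2 (X 1 ^ 3 * X 3 ^ 3 : MvPolynomial (Fin 4) K) = 0 := by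
    simp only [Derivation.leibniz, Derivation.leibniz_pow, smul_eq_mul, nsmul_eq_mul, e21, e23]
    push_cast; ring
  have c3 : pderiv 3 (X 1 ^ 3 * X 3 ^ 3 : MvPolynomial (Fin 4) K) = 0 := by
    simp only [Derivation.leibniz, Derivation.leibniz_pow, smul_eq_mul, nsmul_eq_mul, e31, e33]
    push_cast
    linear_combination (X 1 ^ 3 * X 3 ^ 2 : MvPolynomial (Fin 4) K) * h3
  have hW := Dm_planes (K := K)
  have a1 : (X 1 : MvPolynomial (Fin 4) K) ∈ Ideal.span {(X 0 : MvPolynomial (Fin 4) K), X 1} := Ideal.subset_span (by simp)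
  have b3 : (X 3 : MvPolynomial (Fin 4) K) ∈ Ideal.span {(X 0 : MvPolynomial (Fin 4) K), X 3} := Ideal.subset_span (by simp)
  refine ⟨⟨d0, d1, d3, Dm_pderiv_u⟩, fun i => ?_, ?_⟩
  · fin_cases i
    · exact c0
    · exact c1
    · exact c2
    · exact c3
  · refine Ideal.span_le.2 ?_
    rintro g hg
    simp only [Set.mem_insert_iff, Set.mem_singleton_iff] at hg
    rcases hg with rfl | rfl
    · exact ⟨hW.1, hW.2.1⟩
    · exact ⟨Ideal.mul_mem_right _ _ (Ideal.pow_mem_pow a1 3), Ideal.mul_mem_left _ _ (Ideal.pow_mem_pow b3 3)⟩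

/-- **D′ — WILD (narrow `3`-power form) ALONG THE CROSSING LINE**: `u·t³w³ ∈ (z,t,w)⁴`, so at every point of `L` the
datum is `z³ + (𝔪⁴)`. (Off `L` the narrow form fails — `a·b³·t³` has order `3` — and badness is (B″).) [new; elementary]
[folklore] -/
theorem Dm_wild_L :
    (X 2 * X 1 ^ 3 * X 3 ^ 3 : MvPolynomial (Fin 4) K) ∈ (Ideal.span {(X 0 : MvPolynomial (Fin 4) K), X 1, X 3}) ^ 4 := by
  have a1 : (X 1 : MvPolynomial (Fin 4) K) ∈ Ideal.span {(X 0 : MvPolynomial (Fin 4) K), X 1, X 3} := Ideal.subset_span (by simp)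
  have a3 : (X 3 : MvPolynomial (Fin 4) K) ∈ Ideal.span {(X 0 : MvPolynomial (Fin 4) K), X 1, X 3} := Ideal.subset_span (by simp)
  have h6 : (X 1 ^ 3 * X 3 ^ 3 : MvPolynomial (Fin 4) K) ∈ (Ideal.span {(X 0 : MvPolynomial (Fin 4) K), X 1, X 3}) ^ (3 + 3) :=
    mul_mem_pow_add (Ideal.pow_mem_pow a1 3) (Ideal.pow_mem_pow a3 3)
  have := Ideal.mul_mem_left _ (X 2) (Ideal.pow_le_pow_right (show 4 ≤ 3 + 3 by norm_num) h6)
  rwa [show (X 2 * (X 1 ^ 3 * X 3 ^ 3) : MvPolynomial (Fin 4) K) = X 2 * X 1 ^ 3 * X 3 ^ 3 by ring] at this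

/-- **D′ — (E)+(N) EVERY CLOSED POINT `c = (0,0,a,b)` OF `P_t` HAS A NEAR POINT** (and, by the mirror `σ`, every closed point
of `P_w`): translated to `c` the datum is `z³ + (u+a)·t³·(w+b)³`; chart `u` of the point blow-up at `c` (`z ↦ z·u, t ↦ t·u, w
↦ w·u`) gives `u³ · (z'³ + Φ·t'³)`, `Φ = (u+a)(u·w'+b)³`, and `z'³ + Φ·t'³ ∈ 𝔫'³` for EVERY cofactor `Φ`: the chart origin is
a NEAR point.  So every closed point of `P_t ∪ P_w` is a bad point WITH a near point (δ-heavy): bad₀ = all closed points of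
`P_t ∪ P_w`, closure bad₀ `= P_t ∪ P_w`, NONEMPTY. [new; elementary] [folklore] -/
theorem Dm_near (a b : K) :
    aeval (fun j : Fin 4 => if j = 2 then (X 2 + C a : MvPolynomial (Fin 4) K) else if j = 3 then X 3 + C b else X j)
        (X 0 ^ 3 + X 2 * X 1 ^ 3 * X 3 ^ 3 : MvPolynomial (Fin 4) K) = X 0 ^ 3 + (X 2 + C a) * X 1 ^ 3 * (X 3 + C b) ^ 3 ∧
      aeval (chartSubst (K := K) 2) (X 0 ^ 3 + (X 2 + C a) * X 1 ^ 3 * (X 3 + C b) ^ 3 : MvPolynomial (Fin 4) K) =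
        X 2 ^ 3 * (X 0 ^ 3 + ((X 2 + C a) * (X 2 * X 3 + C b) ^ 3) * X 1 ^ 3) ∧
      ∀ Φ : MvPolynomial (Fin 4) K, (X 0 ^ 3 + Φ * X 1 ^ 3 : MvPolynomial (Fin 4) K) ∈
        (Ideal.span {(X 0 : MvPolynomial (Fin 4) K), X 1, X 2, X 3}) ^ 3 := by
  refine ⟨?_, ?_, fun Φ => ?_⟩
  · simp only [map_add, map_mul, map_pow, aeval_X, Fin.isValue, if_true, show (0 : Fin 4) ≠ 2 by decide,
      show (0 : Fin 4) ≠ 3 by decide, show (1 : Fin 4) ≠ 2 by decide, show (1 : Fin 4) ≠ 3 by decide,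
      show (3 : Fin 4) ≠ 2 by decide, if_false]
  · simp [chartSubst]; ring
  · exact Ideal.add_mem _ (Ideal.pow_mem_pow (X_mem_spanX4 0) 3) (Ideal.mul_mem_left _ Φ (Ideal.pow_mem_pow (X_mem_spanX4 1) 3))

/-- **D′ — (R) THE REDUCED CLOSURE `V((z,t) ∩ (z,w))` OF bad₀ IS NOT REGULAR at the origin** (nor at any point of the crossing
line): `t·w ∈ (z,t) ∩ (z,w)` while `t, w ∉`, and `t, w ∈ (z,t) + (z,w)` — the local ring of `P_t ∪ P_w` at such a point is not
a domain.  The SURFACE PART of the closure is the closure itself (both components are planes), so the surface part is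
IRREGULAR too: `¬ ClosureRegular`, `¬ SurfaceRegular`. [new; elementary] [folklore] -/
theorem Dm_closure_not_prime :
    (X 1 * X 3 : MvPolynomial (Fin 4) K) ∈
        Ideal.span {(X 0 : MvPolynomial (Fin 4) K), X 1} ⊓ Ideal.span {(X 0 : MvPolynomial (Fin 4) K), X 3} ∧
      (X 1 : MvPolynomial (Fin 4) K) ∉
        Ideal.span {(X 0 : MvPolynomial (Fin 4) K), X 1} ⊓ Ideal.span {(X 0 : MvPolynomial (Fin 4) K), X 3} ∧
      (X 3 : MvPolynomial (Fin 4) K) ∉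
        Ideal.span {(X 0 : MvPolynomial (Fin 4) K), X 1} ⊓ Ideal.span {(X 0 : MvPolynomial (Fin 4) K), X 3} := by
  have a1 : (X 1 : MvPolynomial (Fin 4) K) ∈ Ideal.span {(X 0 : MvPolynomial (Fin 4) K), X 1} := Ideal.subset_span (by simp)
  have b3 : (X 3 : MvPolynomial (Fin 4) K) ∈ Ideal.span {(X 0 : MvPolynomial (Fin 4) K), X 3} := Ideal.subset_span (by simp)
  refine ⟨Ideal.mem_inf.2 ⟨Ideal.mul_mem_right _ _ a1, Ideal.mul_mem_left _ _ b3⟩, fun h1 => ?_, fun h3 => ?_⟩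
  · refine not_mem_span_of_eval _ (fun i => if i = 1 then 1 else 0) ?_ (by simp) (Ideal.mem_inf.1 h1).2
    intro g hg
    simp only [Set.mem_insert_iff, Set.mem_singleton_iff] at hg
    rcases hg with rfl | rfl <;> simp
  · refine not_mem_span_of_eval _ (fun i => if i = 3 then 1 else 0) ?_ (by simp) (Ideal.mem_inf.1 h3).1
    intro g hg
    simp only [Set.mem_insert_iff, Set.mem_singleton_iff] at hg
    rcases hg with rfl | rfl <;> simp

/-- **D′ — THE CROSSING LOCUS IS THE LINE `L`**: `(z,t) + (z,w) = (z,t,w)` and `u ∉ (z,t,w)` — the two planes meet along a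
LINE (contrast `Cx`, `G₀`: there the components meet in the POINT `𝔫₀`).  Both planes CONTAIN `L`; `P_t ∪ P_w` is not a
curve (it contains the plane `P_t`: `u, w ∉ (z,t)`). [new; elementary] [folklore] -/
theorem Dm_crossing_line :
    Ideal.span {(X 0 : MvPolynomial (Fin 4) K), X 1} ⊔ Ideal.span {(X 0 : MvPolynomial (Fin 4) K), X 3} =
        Ideal.span {(X 0 : MvPolynomial (Fin 4) K), X 1, X 3} ∧
      (X 2 : MvPolynomial (Fin 4) K) ∉ Ideal.span {(X 0 : MvPolynomial (Fin 4) K), X 1, X 3} := by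
  refine ⟨le_antisymm ?_ ?_, ?_⟩
  · refine sup_le (Ideal.span_le.2 ?_) (Ideal.span_le.2 ?_)
    · rintro g hg
      simp only [Set.mem_insert_iff, Set.mem_singleton_iff] at hg
      rcases hg with rfl | rfl <;> exact Ideal.subset_span (by simp)
    · rintro g hg
      simp only [Set.mem_insert_iff, Set.mem_singleton_iff] at hg
      rcases hg with rfl | rfl <;> exact Ideal.subset_span (by simp)
  · refine Ideal.span_le.2 ?_
    rintro g hg
    simp only [Set.mem_insert_iff, Set.mem_singleton_iff] at hg
    rcases hg with rfl | rfl | rfl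
    · exact Ideal.mem_sup_left (Ideal.subset_span (by simp))
    · exact Ideal.mem_sup_left (Ideal.subset_span (by simp))
    · exact Ideal.mem_sup_right (Ideal.subset_span (by simp))
  · refine not_mem_span_of_eval _ (fun i => if i = 2 then 1 else 0) ?_ (by simp)
    intro g hg
    simp only [Set.mem_insert_iff, Set.mem_singleton_iff] at hg
    rcases hg with rfl | rfl | rfl <;> simp

/-- **NO-TOP FOR UNIT FORMS `1 + u·m` with `∂_u m = 0`**: no prime has order `≥ 3` (indeed `≥ 2`) — `∂_u(1 + u·m) = m`, so an
order witness `s` gives `s²·m ∈ 𝔮² ⊆ 𝔮`, `m ∈ 𝔮`, and then `1 = (1 + u·m) − u·m ∈ 𝔮`.  Characteristic-free. [new;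
elementary] [folklore] -/
theorem noTop_one_add_u_mul (m : MvPolynomial (Fin 4) K) (hm : pderiv 2 m = 0) (𝔮 : Ideal (MvPolynomial (Fin 4) K))
    [𝔮.IsPrime] {s : MvPolynomial (Fin 4) K} (hs : s ∉ 𝔮) (h : s * (1 + X 2 * m) ∈ 𝔮 ^ 3) : False := by
  have hs2 : s ^ 2 ∉ 𝔮 := pow_not_mem 𝔮 hs 2
  have e22 := f_self K 2
  have d2 : pderiv 2 (1 + X 2 * m : MvPolynomial (Fin 4) K) = m := by
    simp only [map_add, Derivation.leibniz, smul_eq_mul, e22, f_one, hm]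
    ring
  have h1 := sq_mul_deriv_mem_pow 𝔮 h (pderiv 2)
  rw [d2] at h1
  have hmq : m ∈ 𝔮 := (‹𝔮.IsPrime›.mem_or_mem (Ideal.pow_le_self two_ne_zero h1)).resolve_left hs2
  have hf : (1 + X 2 * m : MvPolynomial (Fin 4) K) ∈ 𝔮 := mem_of_sMul_mem_cube 𝔮 hs h
  have h1mem : (1 : MvPolynomial (Fin 4) K) ∈ 𝔮 := by
    have := Ideal.sub_mem _ hf (Ideal.mul_mem_left _ (X 2) hmq)
    rwa [show (1 + X 2 * m - X 2 * m : MvPolynomial (Fin 4) K) = 1 by ring] at this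
  exact one_not_mem_of_isPrime 𝔮 h1mem

/-- **SELF-REPRODUCTION, chart `z` — NO top point**: `1 + u·t³w³z³` has no prime of order `≥ 3`.  With `mirrorF_lineChart_t/_w`:
after blowing up `L`, the top locus of level `1` lives in the charts `t` and `w`, each of which IS `(𝔸⁴, (D′))`. [new;
elementary] [folklore] -/
theorem Dm_lineChart_z_noTop (𝔮 : Ideal (MvPolynomial (Fin 4) K)) [𝔮.IsPrime] {s : MvPolynomial (Fin 4) K} (hs : s ∉ 𝔮)
    (h : s * (1 + X 2 * X 1 ^ 3 * X 3 ^ 3 * X 0 ^ 3 : MvPolynomial (Fin 4) K) ∈ 𝔮 ^ 3) : False := by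
  have e20 := f_ne K (i := 2) (j := 0) (by decide)
  have e21 := f_ne K (i := 2) (j := 1) (by decide)
  have e23 := f_ne K (i := 2) (j := 3) (by decide)
  have hm : pderiv 2 (X 1 ^ 3 * X 3 ^ 3 * X 0 ^ 3 : MvPolynomial (Fin 4) K) = 0 := by
    simp only [Derivation.leibniz, Derivation.leibniz_pow, smul_eq_mul, nsmul_eq_mul, e20, e21, e23]
    push_cast; ring
  refine noTop_one_add_u_mul _ hm 𝔮 hs ?_
  rwa [show (1 + X 2 * (X 1 ^ 3 * X 3 ^ 3 * X 0 ^ 3) : MvPolynomial (Fin 4) K) = 1 + X 2 * X 1 ^ 3 * X 3 ^ 3 * X 0 ^ 3 by ring]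

/-- **D′ — THE G-FROZEN CERTIFICATE OF CROSSING TYPE (`GFrozen 3 ⟨(𝔸⁴, (D′)), none⟩` at g-height `0`; a SECOND inhabitant
type of F-surf-sing beside `H`).**  (T) top `⊆ P_t ∪ P_w` (`Dm_top`); (W) both planes lie in the top locus and are planes
(`Dm_planes`); (B″) the order-`≤ 2` differential closure is `(D′, t³w³) ⊆ (z,t)³ ∩ (z,w)³`: every top point is BAD (`Dm_diff`);
(N) every closed point of `P_t` (`P_w` by `σ`) has a NEAR point (`Dm_near`): bad₀ = the closed points of `P_t ∪ P_w`,
closure `= P_t ∪ P_w`, NONEMPTY; (R) the closure — equal to its surface part — is NOT regular at the points of the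
crossing LINE `L = V(z,t,w)` and is not a curve (`Dm_closure_not_prime`, `Dm_crossing_line`).  Separating test (closure
regular), curve test (dim ≤ 1) and surface-part test (surface part regular) all FAIL with nothing pending: the graded run
STAYS at level `0`. [new] [folklore] -/
theorem Dm_gFrozen_certificate [CharP K 3] :
    -- (T)
    (∀ (𝔮 : Ideal (MvPolynomial (Fin 4) K)) [𝔮.IsPrime], ∀ s ∉ 𝔮,
        s * (X 0 ^ 3 + X 2 * X 1 ^ 3 * X 3 ^ 3 : MvPolynomial (Fin 4) K) ∈ 𝔮 ^ 3 →
          (X 0 : MvPolynomial (Fin 4) K) ∈ 𝔮 ∧ ((X 1 : MvPolynomial (Fin 4) K) ∈ 𝔮 ∨ (X 3 : MvPolynomial (Fin 4) K) ∈ 𝔮)) ∧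
    -- (W)
      ((X 0 ^ 3 + X 2 * X 1 ^ 3 * X 3 ^ 3 : MvPolynomial (Fin 4) K) ∈ (Ideal.span {(X 0 : MvPolynomial (Fin 4) K), X 1}) ^ 3 ∧
        (X 0 ^ 3 + X 2 * X 1 ^ 3 * X 3 ^ 3 : MvPolynomial (Fin 4) K) ∈ (Ideal.span {(X 0 : MvPolynomial (Fin 4) K), X 3}) ^ 3 ∧
        ((X 2 : MvPolynomial (Fin 4) K) ∉ Ideal.span {(X 0 : MvPolynomial (Fin 4) K), X 1} ∧
          (X 3 : MvPolynomial (Fin 4) K) ∉ Ideal.span {(X 0 : MvPolynomial (Fin 4) K), X 1}) ∧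
        ((X 1 : MvPolynomial (Fin 4) K) ∉ Ideal.span {(X 0 : MvPolynomial (Fin 4) K), X 3} ∧
          (X 2 : MvPolynomial (Fin 4) K) ∉ Ideal.span {(X 0 : MvPolynomial (Fin 4) K), X 3})) ∧
    -- (B″)
      ((pderiv 0 (X 0 ^ 3 + X 2 * X 1 ^ 3 * X 3 ^ 3 : MvPolynomial (Fin 4) K) = 0 ∧
          pderiv 1 (X 0 ^ 3 + X 2 * X 1 ^ 3 * X 3 ^ 3 : MvPolynomial (Fin 4) K) = 0 ∧
          pderiv 3 (X 0 ^ 3 + X 2 * X 1 ^ 3 * X 3 ^ 3 : MvPolynomial (Fin 4) K) = 0 ∧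
          pderiv 2 (X 0 ^ 3 + X 2 * X 1 ^ 3 * X 3 ^ 3 : MvPolynomial (Fin 4) K) = X 1 ^ 3 * X 3 ^ 3) ∧
        (∀ i : Fin 4, pderiv i (X 1 ^ 3 * X 3 ^ 3 : MvPolynomial (Fin 4) K) = 0) ∧
        Ideal.span {(X 0 ^ 3 + X 2 * X 1 ^ 3 * X 3 ^ 3 : MvPolynomial (Fin 4) K), X 1 ^ 3 * X 3 ^ 3} ≤
          (Ideal.span {(X 0 : MvPolynomial (Fin 4) K), X 1}) ^ 3 ⊓ (Ideal.span {(X 0 : MvPolynomial (Fin 4) K), X 3}) ^ 3) ∧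
    -- (N)
      (∀ a b : K,
        aeval (chartSubst (K := K) 2) (X 0 ^ 3 + (X 2 + C a) * X 1 ^ 3 * (X 3 + C b) ^ 3 : MvPolynomial (Fin 4) K) =
          X 2 ^ 3 * (X 0 ^ 3 + ((X 2 + C a) * (X 2 * X 3 + C b) ^ 3) * X 1 ^ 3)) ∧
      (∀ Φ : MvPolynomial (Fin 4) K, (X 0 ^ 3 + Φ * X 1 ^ 3 : MvPolynomial (Fin 4) K) ∈
        (Ideal.span {(X 0 : MvPolynomial (Fin 4) K), X 1, X 2, X 3}) ^ 3) ∧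
    -- (R)
      ((X 1 * X 3 : MvPolynomial (Fin 4) K) ∈
          Ideal.span {(X 0 : MvPolynomial (Fin 4) K), X 1} ⊓ Ideal.span {(X 0 : MvPolynomial (Fin 4) K), X 3} ∧
        (X 1 : MvPolynomial (Fin 4) K) ∉
          Ideal.span {(X 0 : MvPolynomial (Fin 4) K), X 1} ⊓ Ideal.span {(X 0 : MvPolynomial (Fin 4) K), X 3} ∧
        (X 3 : MvPolynomial (Fin 4) K) ∉
          Ideal.span {(X 0 : MvPolynomial (Fin 4) K), X 1} ⊓ Ideal.span {(X 0 : MvPolynomial (Fin 4) K), X 3}) ∧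
      (Ideal.span {(X 0 : MvPolynomial (Fin 4) K), X 1} ⊔ Ideal.span {(X 0 : MvPolynomial (Fin 4) K), X 3} =
          Ideal.span {(X 0 : MvPolynomial (Fin 4) K), X 1, X 3} ∧
        (X 2 : MvPolynomial (Fin 4) K) ∉ Ideal.span {(X 0 : MvPolynomial (Fin 4) K), X 1, X 3}) :=
  ⟨fun 𝔮 _ _ hs h => Dm_top 𝔮 hs h, Dm_planes, Dm_diff, fun a b => (Dm_near a b).2.1, fun Φ => (Dm_near 0 0).2.2 Φ,
    Dm_closure_not_prime, Dm_crossing_line⟩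

/-- **D′ — THE SYMMETRY AND SELF-REPRODUCTION CERTIFICATE (the barrier's kernel core, `p = 3`).**  (M) mirror `σ` fixes `D′`;
(F) the Frobenius shear `τ_c` fixes `D′` for every `c`; (S) the scalings `μ_λ` fix `D′`; (L) blowing up the crossing line
`L`: charts `t`, `w` return `D′` LITERALLY, chart `z` has no top point.  Reading (NODE-g29.md §2): every memoryless, local,
`Aut`-equivariant, one-regular-centre law freezes at `D′` or blows up `L` and meets two copies of `D′` again — for ever.
[new] [folklore] -/
theorem Dm_selfReproduction_certificate [CharP K 3] :
    rename (Equiv.swap 1 3) (mirrorF (K := K) 3) = mirrorF 3 ∧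
    (∀ c : K, aeval (fun j : Fin 4 => if j = 0 then (X 0 - C c * X 1 * X 3 : MvPolynomial (Fin 4) K)
        else if j = 2 then X 2 + C (c ^ 3) else X j) (mirrorF (K := K) 3) = mirrorF 3) ∧
    (∀ l : K, l ≠ 0 → aeval (fun j : Fin 4 => if j = 2 then (C ((l⁻¹) ^ 3) * X 2 : MvPolynomial (Fin 4) K)
        else if j = 3 then C l * X 3 else X j) (mirrorF (K := K) 3) = mirrorF 3) ∧
    (aeval (linChartSubst (K := K) {0, 1, 3} 1) (mirrorF (K := K) 3) = X 1 ^ 3 * mirrorF 3 ∧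
      aeval (linChartSubst (K := K) {0, 1, 3} 3) (mirrorF (K := K) 3) = X 3 ^ 3 * mirrorF 3 ∧
      aeval (linChartSubst (K := K) {0, 1, 3} 0) (mirrorF (K := K) 3) = X 0 ^ 3 * (1 + X 2 * X 1 ^ 3 * X 3 ^ 3 * X 0 ^ 3)) ∧
    (∀ (𝔮 : Ideal (MvPolynomial (Fin 4) K)) [𝔮.IsPrime], ∀ s ∉ 𝔮,
        s * (1 + X 2 * X 1 ^ 3 * X 3 ^ 3 * X 0 ^ 3 : MvPolynomial (Fin 4) K) ∈ 𝔮 ^ 3 → False) := by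
  haveI : Fact (Nat.Prime 3) := ⟨Nat.prime_three⟩
  exact ⟨mirrorF_swap 3, fun c => mirrorF_shear 3 c, fun l hl => mirrorF_scale 3 hl,
    ⟨mirrorF_lineChart_t 3, mirrorF_lineChart_w 3, mirrorF_lineChart_z 3⟩, fun 𝔮 _ _ hs h => Dm_lineChart_z_noTop 𝔮 hs h⟩

end MCertificatesB

end Summit.ResolutionOfSingularities.ResolutionOfSingularities.Theorems.DeltaCutClasses
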